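import Summits.FinalStateConjecture.FinalStateConjecture.Theorems.PhotonSphereChannelsDarkFutureDefs
import Literature.Geometry.Lorentzian.CauchyDevelopmentAcausal
import Literature.Geometry.Lorentzian.NormalisedNullRayCausal
import Literature.Geometry.Lorentzian.CausalityPushUp
import HarnessLib

/-!
# Crux `ChannelsResolveTameDevelopmentsR` (K2R-T2, stmt-FinalStateConjecture-17430), line `dark-future-exactness`,
# glue M0 of stub T′ `stub_tameEndgame`: ONE future-complete normalised null ray from `Σ` makes the outer region nonempty

Reshape 1 of the line's skeleton (`Cruxes/ChannelsResolveTameDevelopmentsR/Lines/dark_future_exactness.lean`) guards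
stub T′ by `(outerRegion 𝒟).Nonempty` (on the empty fibre its hull hypotheses (a)–(d) are vacuous,
`DarkFuture.forall_not_isFutureEscaping_iff_outerRegion_eq_empty`, `…RTameEndgame.lean`). The guard is discharged
from the content of the crux — an honest `N = 0` decomposition yields a future-complete ray — by the registered glue
sub-goal `outerRegion_nonempty_of_completeRay` proved here, PURE CAUSAL THEORY on a Cauchy development (no vacuum,
tameness, maximality or complete `𝓘⁺`):

`outerRegion 𝒟 = J⁺(ι X) ∩ {q | q ∈ I⁻(γ '' (dom ∩ [0, ∞))) for some future-complete normalised ray γ from Σ}`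
(`TameHull.outerRegion`, verbatim the `let outer` of the route decl). Given ONE such ray `γ` from `p` with
`¬ BddAbove dom`, pick `t > 0` in `dom`; then `γ t ∈ J⁺(ι X)` (`IsNormalisedNullRayFrom.mem_causalFuture_range`,
O'Neill 1983, Ch. 14, p. 402), the horismos of the Cauchy hypersurface is trivial, `J⁺(ι X) ⊆ ι(X) ∪ I⁺(ι X)`
(`CauchyDevelopment.causalFuture_range_embed_subset_union`, O'Neill Lemma 14.42), and `γ t ∈ ι(X)` would make
`γ|[0, t]` a future causal curve from `ι(X)` back to the ACAUSAL `ι(X)`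
(`CauchyDevelopment.false_of_isFutureCausalCurveOn_range_embed`). Hence `γ t ∈ I⁺(ι X)`: some DATA POINT `ι x ≪ γ t`,
and `ι x ∈ ι(X) ⊆ J⁺(ι X)` lies in `I⁻(γ t) ⊆ I⁻(γ '' (dom ∩ [0, ∞)))` — an outer point (indeed a point of `Σ`:
`exists_embed_mem_outerRegion_of_completeRay`).

References: B. O'Neill, *Semi-Riemannian geometry*, Academic Press 1983, Ch. 14, p. 402 (the relations `≪`, `≤`),
Lemma 14.42 (p. 425: a spacelike Cauchy hypersurface is acausal) [ONeillSemiRiemannian1983]; S. W. Hawking,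
G. F. R. Ellis, *The large scale structure of space-time*, CUP 1973, §6.5, §9.2 [HawkingEllis1973CUP].
-/

noncomputable section

-- the operator-norm instance on `E4 →L[ℝ] E4 →L[ℝ] ℝ` needs one more level of pending
-- instance problems than the default (as in `PhotonSphereChannelsKerrDevDefs.lean`)
set_option maxSynthPendingDepth 3
-- every `Summit.FinalStateConjecture.FinalStateConjecture.…` name repeats the summit = sub-problem segment (D-0017 layout)
set_option linter.dupNamespace false

open Set Filter Function TopologicalSpace Manifold Bundle
open scoped Topology Manifold ContDiff ENNReal NNReal

namespace Summit.FinalStateConjecture.FinalStateConjecture.Theorems.DarkFuture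

open Literature.Geometry.Lorentzian
open Summit.FinalStateConjecture.FinalStateConjecture.Theorems.TameHull

section Development
variable {X : Type} [TopologicalSpace X] [ChartedSpace E3 X] [IsManifold (𝓡 3) ∞ X]
  [ConnectedSpace X] {D : InitialDataSet (𝓡 3) X}

/-- **A ray point of POSITIVE parameter lies in the chronological future of the data** (vacuum-development copy of
the Cauchy-development statement): `γ t ∈ J⁺(ι X) ⊆ ι(X) ∪ I⁺(ι X)` (trivial horismos of the Cauchy hypersurface),
and `γ t ∈ ι(X)` with `t > 0` would make `γ|[0, t]` a future causal curve from `ι(X)` back to the acausal `ι(X)`.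
[cite: ONeillSemiRiemannian1983, Ch. 14, Lemma 14.42 (p. 425)] -/
theorem mem_chronologicalFuture_range_embed_of_pos (𝒟 : VacuumCauchyDevelopment D) [𝒟.metric.HasLeviCivita]
    {p : X} {γ : ℝ → 𝒟.carrier} {dom : Set ℝ}
    (hγ : 𝒟.metric.IsNormalisedNullRayFrom 𝒟.timeOrientation 𝒟.embed 𝒟.normal p γ dom)
    {t : ℝ} (ht : t ∈ dom) (h0 : 0 < t) :
    γ t ∈ 𝒟.metric.chronologicalFuture 𝒟.timeOrientation (range 𝒟.embed) := by
  rcases 𝒟.toCauchyDevelopment.causalFuture_range_embed_subset_union (hγ.mem_causalFuture_range ht h0.le) with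
    hS | hI
  · exact (𝒟.toCauchyDevelopment.false_of_isFutureCausalCurveOn_range_embed h0
      (hγ.isFutureCausalCurveOn.mono (hγ.isMaximalGeodesicOn.2.1.out hγ.zero_mem ht))
      (by rw [hγ.apply_zero]; exact mem_range_self p) hS).elim
  · exact hI

/-- **A data point chronologically before a point of the future branch of a future-complete normalised ray is an
outer point**: `ι x ∈ ι(X) ⊆ J⁺(ι X)` and `ι x ∈ I⁻(γ t) ⊆ I⁻(γ '' (dom ∩ [0, ∞)))`.
[cite: HawkingEllis1973CUP, §9.2 (p. 312)] -/
theorem embed_mem_outerRegion_of_mem_chronologicalFuture (𝒟 : VacuumCauchyDevelopment D)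
    [𝒟.metric.HasLeviCivita] {p : X} {γ : ℝ → 𝒟.carrier} {dom : Set ℝ}
    (hγ : 𝒟.metric.IsNormalisedNullRayFrom 𝒟.timeOrientation 𝒟.embed 𝒟.normal p γ dom)
    (hdom : ¬ BddAbove dom) {t : ℝ} (ht : t ∈ dom) (h0 : 0 ≤ t) {x : X}
    (hx : γ t ∈ 𝒟.metric.chronologicalFuture 𝒟.timeOrientation {𝒟.embed x}) :
    𝒟.embed x ∈ outerRegion 𝒟 := by
  have hmem : γ t ∈ γ '' (dom ∩ Ici 0) := mem_image_of_mem γ ⟨ht, h0⟩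
  refine ⟨LorentzianMetric.subset_causalFuture _ _ _ (mem_range_self x), p, γ, dom, hγ, hdom, ?_⟩
  exact LorentzianMetric.chronologicalPast_mono (singleton_subset_iff.2 hmem)
    (LorentzianMetric.mem_chronologicalPast_of_mem_chronologicalFuture hx)

/-- **One future-complete normalised null ray from `Σ` puts a DATA POINT in the outer region**: for `t > 0` in the
(unbounded) affine domain, `γ t ∈ I⁺(ι X)` (`mem_chronologicalFuture_range_embed_of_pos`), i.e. `ι x ≪ γ t` for some
`x : X`, and that `ι x` is an outer point (`embed_mem_outerRegion_of_mem_chronologicalFuture`).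
[cite: HawkingEllis1973CUP, §9.2 (p. 312)] -/
theorem exists_embed_mem_outerRegion_of_completeRay (𝒟 : VacuumCauchyDevelopment D) [𝒟.metric.HasLeviCivita]
    {p : X} {γ : ℝ → 𝒟.carrier} {dom : Set ℝ}
    (hγ : 𝒟.metric.IsNormalisedNullRayFrom 𝒟.timeOrientation 𝒟.embed 𝒟.normal p γ dom)
    (hdom : ¬ BddAbove dom) : ∃ x : X, 𝒟.embed x ∈ outerRegion 𝒟 := by
  -- a positive parameter of the affine domain
  obtain ⟨t, ht, h0t⟩ : ∃ t ∈ dom, (0 : ℝ) < t := not_bddAbove_iff.1 hdom 0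
  -- a data point `ι x ≪ γ t`
  obtain ⟨_, ⟨x, rfl⟩, σ, a, b, hab, hσ, hσa, hσb⟩ := mem_chronologicalFuture_range_embed_of_pos 𝒟 hγ ht h0t
  exact ⟨x, embed_mem_outerRegion_of_mem_chronologicalFuture 𝒟 hγ hdom ht h0t.le
    ⟨𝒟.embed x, rfl, σ, a, b, hab, hσ, hσa, hσb⟩⟩

end Development

/-- **Registered glue sub-goal `outerRegion_nonempty_of_completeRay` (M0) of stub T′ `stub_tameEndgame`, line
`dark-future-exactness`, crux stmt-FinalStateConjecture-17430**: in a vacuum Cauchy development of admissible-type data,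
ONE future-complete normalised null ray from the data hypersurface makes the outer region
`outerRegion 𝒟 = J⁺(ι X) ∩ ⋃ I⁻(future branches of future-complete normalised rays from Σ)` nonempty — it contains a
data point `ι x ≪ γ t`, `t > 0` (`exists_embed_mem_outerRegion_of_completeRay`). Pure causal theory: trivial horismos
and acausality of the Cauchy hypersurface (O'Neill 1983, Lemma 14.42). [cite: ONeillSemiRiemannian1983, Ch. 14, Lemma 14.42 (p. 425)] -/
theorem outerRegion_nonempty_of_completeRay : ∀ {X : Type} [TopologicalSpace X] [ChartedSpace E3 X] [IsManifold (𝓡 3) ∞ X] [T2Space X] [SecondCountableTopology X] [ConnectedSpace X] {D : InitialDataSet (𝓡 3) X} (𝒟 : VacuumCauchyDevelopment D) [𝒟.metric.HasLeviCivita] (p : X) (γ : ℝ → 𝒟.carrier) (dom : Set ℝ), 𝒟.metric.IsNormalisedNullRayFrom 𝒟.timeOrientation 𝒟.embed 𝒟.normal p γ dom → ¬ BddAbove dom → (outerRegion 𝒟).Nonempty := by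
  intro X _ _ _ _ _ _ D 𝒟 _ p γ dom hγ hdom
  obtain ⟨x, hx⟩ := exists_embed_mem_outerRegion_of_completeRay 𝒟 hγ hdom
  exact ⟨𝒟.embed x, hx⟩

end Summit.FinalStateConjecture.FinalStateConjecture.Theorems.DarkFuture

end
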